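import Mathlib
import Summits.Ventures.HodgeRepro2.T5DifferentNorm

/-! # T5DifferentValuation — «v_F(N𝔇) = f · d»: the norm of the different `𝔇 = P^d` is `p^{f d}`

Blind cell pub-hodge-repro2, seat p4 (Tier-5 kernel annex, README §7; record-class, cited by p-id
or ignored, never an input). README §8(d): uses an L-value-free non-vanishing device: NO.

The local-field dictionary behind the last words of (A13) (route/T5-route-2.md §N5.13.2,
(iii-ramified)′: «`v_F(disc(O_{E_v})) = v_F(N𝔇) = d(E_v/F_v)` as the residue degree is 1») —
with `d(E_v/F_v) := v_E(𝔇)`, i.e. `𝔇 = P_E^d`, the norm of `𝔇` is `P_F^{f d}` with `f` the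
residue degree. Mathlib's `Ideal.relNorm_eq_pow_of_isMaximal` (`relNorm A P = p ^ inertiaDeg`)
makes this a two-line kernel fact for Dedekind domains `A ⊆ B` (`B` finite torsion-free over `A`,
`Frac A` perfect), no local field modelled:
* `relNorm_differentIdeal_eq_pow` : `differentIdeal A B = P ^ d`, `P` maximal over the maximal
  `p` ⇒ `relNorm A (differentIdeal A B) = p ^ (P.inertiaDeg A * d)`;
* `span_norm_eq_pow` : if moreover `differentIdeal A B = span {x}` and `B` is free over `A`,
  `span {Algebra.norm A x} = p ^ (f d)` (`Ideal.relNorm_singleton`, `Algebra.intNorm_eq_norm`);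
* `exists_unit_norm_eq_pow` / `val_norm_eq_val_pow` : with `p = span {ϖ}` (`ϖ = π_F`),
  `norm A x = u * ϖ ^ (f d)` for a unit `u`, hence `v (norm A x) = v ϖ ^ (f d)` for every valuation
  `v ≤ 1` on `A` — «`v_F(N𝔇) = f · d`, `= d` at residue degree 1».

With `T5DifferentNorm.val_norm_eq_val_discr` (p394153: `v (norm A x) = v (discr A b)`) this gives
«`v_F(disc O_{E_v}) = f · d(E_v/F_v)`» in the kernel; the combination is `val_discr_eq_val_pow`
(section `Combination`).

Stays prose: that `O_{E_v}` IS the integral closure of `O_{F_v}` in `E_v`, free of rank 2, with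
`𝔇 = P_E^{d}` the definition of the different exponent, and `f = 1` at a ramified quadratic place.
-/

namespace Summit.Ventures.HodgeRepro2.T5DifferentValuation

open Ideal

section RelNorm

variable (A B : Type*) [CommRing A] [CommRing B] [IsDedekindDomain A] [IsDedekindDomain B]
  [Algebra A B] [Module.Finite A B] [Module.IsTorsionFree A B] [PerfectField (FractionRing A)]

/-- `relNorm A 𝔇 = p ^ (f · d)` when `𝔇 = P ^ d` with `P` maximal over the maximal ideal `p`
(`Ideal.relNorm_eq_pow_of_isMaximal`, `f = P.inertiaDeg A`). -/
theorem relNorm_differentIdeal_eq_pow (P : Ideal B) (p : Ideal A) [P.LiesOver p] [P.IsMaximal]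
    [p.IsMaximal] (d : ℕ) (hD : differentIdeal A B = P ^ d) :
    Ideal.relNorm A (differentIdeal A B) = p ^ (P.inertiaDeg A * d) := by
  rw [hD, map_pow, Ideal.relNorm_eq_pow_of_isMaximal P p, ← pow_mul]

/-- If `𝔇 = P ^ d = span {x}` and `B` is free over `A`, then `span {norm A x} = p ^ (f · d)`. -/
theorem span_norm_eq_pow [Module.Free A B] (P : Ideal B) (p : Ideal A) [P.LiesOver p]
    [P.IsMaximal] [p.IsMaximal] (d : ℕ) (hD : differentIdeal A B = P ^ d) (x : B)
    (hx : differentIdeal A B = Ideal.span {x}) :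
    Ideal.span {Algebra.norm A x} = p ^ (P.inertiaDeg A * d) := by
  have h := relNorm_differentIdeal_eq_pow A B P p d hD
  rwa [hx, Ideal.relNorm_singleton, Algebra.intNorm_eq_norm] at h

/-- With `p = span {ϖ}`: `norm A x = u * ϖ ^ (f · d)` for a unit `u` of `A`. -/
theorem exists_unit_norm_eq_pow [Module.Free A B] (P : Ideal B) (ϖ : A)
    [P.LiesOver (Ideal.span {ϖ})] [P.IsMaximal] [(Ideal.span {ϖ}).IsMaximal] (d : ℕ)
    (hD : differentIdeal A B = P ^ d) (x : B) (hx : differentIdeal A B = Ideal.span {x}) :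
    ∃ u : Aˣ, Algebra.norm A x = u * ϖ ^ (P.inertiaDeg A * d) := by
  have h := span_norm_eq_pow A B P (Ideal.span {ϖ}) d hD x hx
  rw [Ideal.span_singleton_pow, Ideal.span_singleton_eq_span_singleton] at h
  obtain ⟨u, hu⟩ := h.symm
  exact ⟨u, by rw [← hu, mul_comm]⟩

/-- «`v_F(N𝔇) = f · d`»: for a valuation `v ≤ 1` on `A`, `v (norm A x) = v ϖ ^ (f · d)`. -/
theorem val_norm_eq_val_pow [Module.Free A B] {Γ₀ : Type*} [LinearOrderedCommGroupWithZero Γ₀]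
    (v : Valuation A Γ₀) (hv : ∀ a : A, v a ≤ 1) (P : Ideal B) (ϖ : A)
    [P.LiesOver (Ideal.span {ϖ})] [P.IsMaximal] [(Ideal.span {ϖ}).IsMaximal] (d : ℕ)
    (hD : differentIdeal A B = P ^ d) (x : B) (hx : differentIdeal A B = Ideal.span {x}) :
    v (Algebra.norm A x) = v ϖ ^ (P.inertiaDeg A * d) := by
  obtain ⟨u, hu⟩ := exists_unit_norm_eq_pow A B P ϖ d hD x hx
  have h1 : v (u : A) = 1 := by
    obtain ⟨w, hw⟩ := u.isUnit.exists_right_inv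
    have h1 : v u * v w = 1 := by rw [← map_mul, hw, map_one]
    refine le_antisymm (hv u) ?_
    calc (1 : Γ₀) = v u * v w := h1.symm
      _ ≤ v u * 1 := mul_le_mul_right (hv w) _
      _ = v u := mul_one _
  rw [hu, map_mul, h1, one_mul, map_pow]

end RelNorm

section Combination

open scoped nonZeroDivisors

variable (A K L B : Type*) [CommRing A] [Field K] [CommRing B] [Field L]
  [Algebra A K] [Algebra B L] [Algebra A B] [Algebra K L] [Algebra A L]
  [IsScalarTower A K L] [IsScalarTower A B L]
  [IsDedekindDomain A] [IsFractionRing A K] [FiniteDimensional K L] [Algebra.IsSeparable K L]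
  [IsIntegralClosure B A L] [IsDedekindDomain B] [Module.IsTorsionFree A B] [IsFractionRing B L]
  [IsLocalization (Algebra.algebraMapSubmonoid B A⁰) L] [PerfectField (FractionRing A)]

include K L in
/-- **«`v_F(disc O_{E_v}) = f · d(E_v/F_v)`»** in the kernel: in the AKLB setting with `A` a
Dedekind domain, `b` an `A`-basis of `B`, `𝔇 = P ^ d = span {x}`, `P` maximal over
`p = span {ϖ}` maximal, and `v ≤ 1` a valuation on `A`:
`v (discr A b) = v ϖ ^ (P.inertiaDeg A * d)` (`T5DifferentNorm.val_norm_eq_val_discr` p394153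
+ `val_norm_eq_val_pow`). -/
theorem val_discr_eq_val_pow {ι : Type*} [Fintype ι] [DecidableEq ι] (b : Module.Basis ι A B)
    {Γ₀ : Type*} [LinearOrderedCommGroupWithZero Γ₀] (v : Valuation A Γ₀)
    (hv : ∀ a : A, v a ≤ 1) (P : Ideal B) (ϖ : A) [P.LiesOver (Ideal.span {ϖ})] [P.IsMaximal]
    [(Ideal.span {ϖ}).IsMaximal] (d : ℕ) (hD : differentIdeal A B = P ^ d) (x : B)
    (hx : differentIdeal A B = Ideal.span {x}) (hx0 : x ≠ 0) :
    v (Algebra.discr A ⇑b) = v ϖ ^ (P.inertiaDeg A * d) := by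
  haveI : Module.Free A B := Module.Free.of_basis b
  haveI : Module.Finite A B := Module.Finite.of_basis b
  rw [← T5DifferentNorm.val_norm_eq_val_discr A K L B v hv b x hx hx0]
  exact val_norm_eq_val_pow A B v hv P ϖ d hD x hx

end Combination

end Summit.Ventures.HodgeRepro2.T5DifferentValuation
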